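import Literature.AlgebraicGeometry.Limits.SubalgebraSpread
import Literature.AlgebraicGeometry.Limits.LocalizationFiniteEtaleSpread
import Literature.AlgebraicGeometry.Limits.LocalizationSmoothSpread
import Literature.AlgebraicGeometry.Morphisms.FiniteEtaleFpqcDescent
import Mathlib.RingTheory.Localization.FractionRing
import Mathlib.FieldTheory.Perfect
import HarnessLib

/-!
# Spreading out a finite étale cover of `X₀ ⊗_K Ω` to a finite étale cover of `X₀ ⊗_K R`, `R ⊆ Ω` of finite type

Topic: `Literature/AlgebraicGeometry/Limits` (EGA IV₃ 8.8.2 (ii), 8.10.5 (x); EGA IV₄ 17.7.8 (ii);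
SGA1 Exp. XIII; Voisin, *Hodge loci and absolute Hodge classes* (2007), §3 — the algebraic half of
"a finite étale cover of `S₀ ⊗_{ℚ̄} ℂ` is the complex fibre of a finite étale cover of `S₀ × U`
for a `ℚ̄`-variety `U` with a `ℂ`-point").

**Main theorem** (`exists_finite_etale_spread`). Let `K` be a field, `Ω` a field extension,
`X₀` a quasi-compact separated `K`-scheme locally of finite presentation, and
`a : X → X₀ ⊗_K Spec Ω` finite étale. Then there are a `K`-algebra `R` of finite type which is an
integral domain with an injective `K`-algebra map `ψ : R → Ω`, a finite étale
`G : X' → X₀ ⊗_K Spec R` and `π : X → X'` exhibiting `a` as the base change of `G` along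
`ℓ = X₀ ◁ Spec ψ : X₀ ⊗_K Spec Ω → X₀ ⊗_K Spec R` (a cartesian square `IsPullback π a G ℓ`; `ℓ` is
characterised by its two components).

Proof, assembling the sibling files:
1. `Limits/SubalgebraSpread` (EGA IV₃ 8.8.2 (ii)): `a` is the base change of a separated
   `G₁ : X' → X₀ ⊗_K Spec R₁` of finite type, `R₁ ⊆ Ω` a finitely generated `K`-subalgebra.
2. `Morphisms/FiniteEtaleFpqcDescent` (Stacks 02LA, 02VN): the base change of `G₁` to
   `L = Frac R₁` is finite étale, `X₀ ⊗ Spec Ω → X₀ ⊗ Spec L` being flat, surjective and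
   quasi-compact.
3. `Limits/LocalizationFiniteEtaleSpread` (EGA IV₃ 8.10.5 (x), IV₄ 17.7.8 (ii)): `G₁` is finite
   étale over `Spec R₁[1/s]` for some `s ≠ 0`; take `R = R₁[1/s] ⊆ Ω`.
The bookkeeping between `X₀ ⊗_K Spec T` and `(X₀ ⊗_K Spec R₁) ×_{Spec R₁} Spec T`
(`exists_iso_tensorObj_left`) and the transport of the cartesian square are done once, for an
arbitrary `R₁`-algebra `T` mapping to `Ω`, in `exists_spread_package`; the intermediate statement
`exists_model_forall_isFinite_and_etale` keeps the freedom of passing to any `R₁[1/t]`, `s ∣ t`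
(so that a consumer may shrink `Spec R` further, e.g. to make it smooth over a perfect `K`).

Everything is proved; no definitions, no named facts.

## References

* A. Grothendieck, J. Dieudonné, EGA IV₃ Thm. 8.8.2 (ii), Thm. 8.10.5 (x); EGA IV₄ Prop. 17.7.8 (ii).
  [EGAIV3] [EGAIV4]
* A. Grothendieck, SGA 1, Exp. XIII §4 (specialisation of the fundamental group). [SGA1]
* C. Voisin, Hodge loci and absolute Hodge classes, Compos. Math. 143 (2007), §3. [Voisin2007]
* The Stacks Project, Tags 01ZC, 01ZM, 01ZO, 07RP, 02LA, 02VN. [StacksProject]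
-/

noncomputable section

universe u

open CategoryTheory CategoryTheory.Limits AlgebraicGeometry MonoidalCategory

namespace Literature.AlgebraicGeometry.Limits

open Literature.AlgebraicGeometry.Motives (SchemeOver specOver)

set_option backward.isDefEq.respectTransparency false

/-- Over a locally Noetherian base, locally of finite type implies locally of finite presentation
(same proof as `HodgeTheory.locallyOfFinitePresentation_of_isLocallyNoetherian`, kept private to
keep the imports light). [folklore] -/
private theorem locallyOfFinitePresentation_of_isLocallyNoetherian' {X Y : Scheme.{u}} (g : X ⟶ Y)
    [IsLocallyNoetherian Y] [LocallyOfFiniteType g] : LocallyOfFinitePresentation g := by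
  rw [HasRingHomProperty.iff_appLE (P := @LocallyOfFinitePresentation)]
  intro U V e
  haveI := IsLocallyNoetherian.component_noetherian (X := Y) U
  exact RingHom.FinitePresentation.of_finiteType.mp
    (HasRingHomProperty.appLE @LocallyOfFiniteType g inferInstance U V e)

/-! ## `X₀ ⊗_K Spec T ≅ (X₀ ⊗_K Spec R) ×_{Spec R} Spec T` -/

section Stage

variable {K : Type u} [CommRing K] (X₀ : SchemeOver K) (R : Type u) [CommRing R] [Algebra K R]
  (T : Type u) [CommRing T] [Algebra K T] [Algebra R T] [IsScalarTower K R T]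

/-- `Spec T → Spec R → Spec K` is the structure map of `Spec T`. [folklore] -/
theorem specMap_algebraMap_comp_hom :
    Spec.map (CommRingCat.ofHom (algebraMap R T)) ≫ (specOver K R).hom = (specOver K T).hom := by
  change Spec.map _ ≫ Spec.map _ = Spec.map _
  rw [← Spec.map_comp, ← CommRingCat.ofHom_comp, ← IsScalarTower.algebraMap_eq K R T]

/-- **Transitivity of base change**: `X₀ ⊗_K Spec T ≅ (X₀ ⊗_K Spec R) ×_{Spec R} Spec T`, the
right hand side being `(P₁ ⊗ Spec T).left` for the `R`-scheme `P₁ = (X₀ ⊗_K Spec R → Spec R)`, with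
its compatibilities with the projections. [folklore] -/
theorem exists_iso_tensorObj_left :
    ∃ e : (X₀ ⊗ specOver K T).left ≅
        ((Over.mk (pullback.snd X₀.hom (specOver K R).hom) : SchemeOver R) ⊗ specOver R T).left,
      e.hom ≫ pullback.fst _ _ ≫ pullback.fst X₀.hom (specOver K R).hom =
          pullback.fst X₀.hom (specOver K T).hom ∧
      e.hom ≫ pullback.fst _ _ ≫ pullback.snd X₀.hom (specOver K R).hom =
          pullback.snd X₀.hom (specOver K T).hom ≫ Spec.map (CommRingCat.ofHom (algebraMap R T)) ∧
      e.hom ≫ pullback.snd _ _ = pullback.snd X₀.hom (specOver K T).hom := by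
  let ι : specOver K T ⟶ specOver K R :=
    Over.homMk (Spec.map (CommRingCat.ofHom (algebraMap R T))) (specMap_algebraMap_comp_hom R T)
  have h₁ : IsPullback (X₀ ◁ ι).left (pullback.snd X₀.hom (specOver K T).hom)
      (pullback.snd X₀.hom (specOver K R).hom) (specOver R T).hom :=
    SubalgApprox.isPullback_whiskerLeft_left X₀ ι
  have h₂ : IsPullback
      (pullback.fst (Over.mk (pullback.snd X₀.hom (specOver K R).hom) : SchemeOver R).hom
        (specOver R T).hom)
      (pullback.snd (Over.mk (pullback.snd X₀.hom (specOver K R).hom) : SchemeOver R).hom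
        (specOver R T).hom)
      (pullback.snd X₀.hom (specOver K R).hom) (specOver R T).hom :=
    IsPullback.of_hasPullback (pullback.snd X₀.hom (specOver K R).hom) (specOver R T).hom
  refine ⟨h₁.isoIsPullback _ _ h₂, ?_, ?_, ?_⟩
  · exact (h₁.isoIsPullback_hom_fst_assoc _ _ h₂ _).trans (Over.whiskerLeft_left_fst ι)
  · exact (h₁.isoIsPullback_hom_fst_assoc _ _ h₂ _).trans (Over.whiskerLeft_left_snd ι)
  · exact h₁.isoIsPullback_hom_snd _ _ h₂

end Stage

/-! ## Packaging: transporting the cartesian squares of base change along the comparison isos -/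

section Package

variable {K : Type u} [CommRing K] {Ω : Type u} [CommRing Ω] [Algebra K Ω] (X₀ : SchemeOver K)
  {R : Type u} [CommRing R] [Algebra R Ω]
  {Xo P₁ : SchemeOver R} (f : Xo ⟶ P₁) (u : P₁.left ⟶ X₀.left)
  {X : Scheme.{u}} (a : X ⟶ (X₀ ⊗ specOver K Ω).left) (π₁ : X ⟶ Xo.left)
  (eΩ : (X₀ ⊗ specOver K Ω).left ≅ (P₁ ⊗ specOver R Ω).left)

/-- **The given cover is the base change of the model to `Ω`, as an arrow**: if `a` is the base
change of `f.left : Xo → P₁` along `X₀ ⊗_K Spec Ω ≅ (P₁ ⊗ Spec Ω).left → P₁.left`, then `X` is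
isomorphic to `(Xo ⊗ Spec Ω).left`, compatibly with `a`, `(f ▷ Spec Ω).left` and the projection.
[folklore] -/
theorem exists_iso_of_isPullback
    (hsq : IsPullback π₁ a f.left (eΩ.hom ≫ pullback.fst P₁.hom (specOver R Ω).hom)) :
    ∃ χ : X ≅ (Xo ⊗ specOver R Ω).left,
      χ.hom ≫ (f ▷ specOver R Ω).left = a ≫ eΩ.hom ∧
      χ.hom ≫ pullback.fst Xo.hom (specOver R Ω).hom = π₁ := by
  -- the base change square of `f`, composed with the iso `eΩ`
  have t : IsPullback (pullback.fst Xo.hom (specOver R Ω).hom) (f ▷ specOver R Ω).left f.left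
      (pullback.fst P₁.hom (specOver R Ω).hom) :=
    (LocApprox.isPullback_whiskerRight_left f (specOver R Ω)).flip
  have hiso : IsPullback (𝟙 _) ((f ▷ specOver R Ω).left ≫ eΩ.inv) (f ▷ specOver R Ω).left eΩ.hom :=
    IsPullback.of_horiz_isIso ⟨by simp only [Category.id_comp, Category.assoc, Iso.inv_hom_id,
      Category.comp_id]⟩
  have sq2 : IsPullback (pullback.fst Xo.hom (specOver R Ω).hom)
      ((f ▷ specOver R Ω).left ≫ eΩ.inv) f.left (eΩ.hom ≫ pullback.fst P₁.hom (specOver R Ω).hom) := by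
    simpa only [Category.id_comp] using hiso.paste_horiz t
  refine ⟨hsq.isoIsPullback _ _ sq2, ?_, hsq.isoIsPullback_hom_fst _ _ sq2⟩
  have h := hsq.isoIsPullback_hom_snd _ _ sq2
  rw [← cancel_mono eΩ.inv, Category.assoc, Category.assoc, eΩ.hom_inv_id, Category.comp_id]
  exact h

variable (T : Type u) [CommRing T] [Algebra K T] [Algebra R T] (φ : T →+* Ω)
  (χ : X ≅ (Xo ⊗ specOver R Ω).left) (eT : (X₀ ⊗ specOver K T).left ≅ (P₁ ⊗ specOver R T).left)

/-- **Packaging at a stage `T`.** Let `a` be isomorphic as an arrow to `(f ▷ Spec Ω).left` via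
`χ` and `eΩ`, let `T` be an `R`-algebra with a ring map `φ : T → Ω` under `R`, and let
`eT : X₀ ⊗_K Spec T ≅ (P₁ ⊗ Spec T).left` be compatible with the projections (`u : P₁.left → X₀`
the first projection of `P₁ = X₀ ⊗_K Spec R`). Then `a` is the base change, along a morphism
`ℓ : X₀ ⊗_K Spec Ω → X₀ ⊗_K Spec T` with components `(pr₁, pr₂ ≫ Spec φ)`, of a morphism
`G : X'' → X₀ ⊗_K Spec T` isomorphic as an arrow to `(f ▷ Spec T).left` — so that every property of
morphisms respecting isomorphisms passes from `(f ▷ Spec T).left` to `G` (the cartesian square of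
the base changes `Spec Ω → Spec T`, `LocApprox.isPullback_whiskerLeft_whiskerRight_left`,
transported along `χ`, `eΩ`, `eT`). [folklore] -/
theorem exists_spread_package (hφ : Spec.map (CommRingCat.ofHom φ) ≫ (specOver R T).hom = (specOver R Ω).hom)
    (hχ : χ.hom ≫ (f ▷ specOver R Ω).left = a ≫ eΩ.hom)
    (heΩ₁ : eΩ.hom ≫ pullback.fst _ _ ≫ u = pullback.fst _ _)
    (heΩ₃ : eΩ.hom ≫ pullback.snd _ _ = pullback.snd _ _)
    (heT₁ : eT.hom ≫ pullback.fst _ _ ≫ u = pullback.fst _ _)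
    (heT₃ : eT.hom ≫ pullback.snd _ _ = pullback.snd _ _) :
    ∃ (X'' : Scheme.{u}) (G : X'' ⟶ (X₀ ⊗ specOver K T).left) (π : X ⟶ X'')
      (ℓ : (X₀ ⊗ specOver K Ω).left ⟶ (X₀ ⊗ specOver K T).left),
      ℓ ≫ pullback.fst _ _ = pullback.fst _ _ ∧
      ℓ ≫ pullback.snd _ _ = pullback.snd _ _ ≫ Spec.map (CommRingCat.ofHom φ) ∧
      IsPullback π a G ℓ ∧
      ∀ P : MorphismProperty Scheme.{u}, P.RespectsIso → P (f ▷ specOver R T).left → P G := by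
  let ι : specOver R Ω ⟶ specOver R T := Over.homMk (Spec.map (CommRingCat.ofHom φ)) hφ
  -- the cartesian square of base changes `Ω → T`
  have W := LocApprox.isPullback_whiskerLeft_whiskerRight_left f (specOver R T) ι
  refine ⟨(Xo ⊗ specOver R T).left, (f ▷ specOver R T).left ≫ eT.inv, χ.hom ≫ (Xo ◁ ι).left,
    eΩ.hom ≫ (P₁ ◁ ι).left ≫ eT.inv, ?_, ?_, ?_, ?_⟩
  · -- `ℓ ≫ pr₁ = pr₁`
    have h1 : eT.inv ≫ pullback.fst X₀.hom (specOver K T).hom =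
        pullback.fst P₁.hom (specOver R T).hom ≫ u := by
      rw [Iso.inv_comp_eq]; exact heT₁.symm
    rw [Category.assoc, Category.assoc, h1, Over.whiskerLeft_left_fst_assoc]
    exact heΩ₁
  · -- `ℓ ≫ pr₂ = pr₂ ≫ Spec φ`
    have h2 : eT.inv ≫ pullback.snd X₀.hom (specOver K T).hom =
        pullback.snd P₁.hom (specOver R T).hom := by
      rw [Iso.inv_comp_eq]; exact heT₃.symm
    rw [Category.assoc, Category.assoc, h2, Over.whiskerLeft_left_snd, ← Category.assoc, heΩ₃]
    rfl
  · refine W.of_iso χ.symm (Iso.refl _) eΩ.symm eT.symm ?_ ?_ ?_ ?_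
    · simp only [Iso.refl_hom, Category.comp_id, Iso.symm_hom, Iso.inv_hom_id_assoc]
    · rw [Iso.symm_hom, Iso.symm_hom, Iso.eq_inv_comp, ← cancel_mono eΩ.hom, Category.assoc,
        Category.assoc, eΩ.inv_hom_id, Category.comp_id]
      exact hχ
    · simp only [Iso.refl_hom, Category.id_comp, Iso.symm_hom]
    · simp only [Iso.symm_hom, Iso.inv_hom_id_assoc]
  · intro P hP h
    haveI := hP
    exact (P.cancel_right_of_respectsIso _ eT.inv).mpr h

end Package

/-! ## The main theorems -/

section Main

variable {K : Type u} [Field K] {Ω : Type u} [Field Ω] [Algebra K Ω]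
  (X₀ : SchemeOver K) [QuasiCompact X₀.hom] [IsSeparated X₀.hom] [LocallyOfFinitePresentation X₀.hom]
  {X : Scheme.{u}} (a : X ⟶ (X₀ ⊗ specOver K Ω).left) [IsFinite a] [Etale a]

/-- **A model over a finitely generated subalgebra, finite étale over a dense open** (EGA IV₃
8.8.2 (ii) + fpqc descent to `Frac R` + EGA IV₃ 8.10.5 (x) / IV₄ 17.7.8 (ii)). For
`a : X → X₀ ⊗_K Spec Ω` finite étale there are an integral domain `R` of finite type over `K`, made a
subalgebra of `Ω` (`algebraMap R Ω` injective, `K → R → Ω` a tower), a separated morphism of `R`-schemes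
`f : Xo → P₁ = (X₀ ⊗_K Spec R → Spec R)` whose base change `(f ▷ Spec Ω).left` is isomorphic to `a` as an
arrow (`χ`, `eΩ`, with `eΩ` compatible with the projections), and `s ≠ 0` in `R` such that
`(f ▷ Spec T).left` is finite étale for every model `T` of `R[1/t]`, `t` any multiple of `s`.
[cite: EGAIV3, Thm. 8.8.2 (ii) and Thm. 8.10.5 (x)] [cite: EGAIV4, Prop. 17.7.8 (ii)] -/
theorem exists_model_forall_isFinite_and_etale :
    ∃ (R : Type u) (_ : CommRing R) (_ : IsDomain R) (_ : Algebra K R) (_ : Algebra R Ω)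
      (_ : IsScalarTower K R Ω) (Xo : SchemeOver R)
      (f : Xo ⟶ Over.mk (pullback.snd X₀.hom (specOver K R).hom))
      (χ : X ≅ (Xo ⊗ specOver R Ω).left)
      (eΩ : (X₀ ⊗ specOver K Ω).left ≅
        ((Over.mk (pullback.snd X₀.hom (specOver K R).hom) : SchemeOver R) ⊗ specOver R Ω).left)
      (s : R),
      Function.Injective (algebraMap R Ω) ∧ Algebra.FiniteType K R ∧
      χ.hom ≫ (f ▷ specOver R Ω).left = a ≫ eΩ.hom ∧
      eΩ.hom ≫ pullback.fst _ _ ≫ pullback.fst X₀.hom (specOver K R).hom = pullback.fst _ _ ∧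
      eΩ.hom ≫ pullback.snd _ _ = pullback.snd _ _ ∧ s ≠ 0 ∧
      ∀ t : R, s ∣ t → ∀ (T : Type u) [CommRing T] [Algebra R T] [IsLocalization.Away t T],
        IsFinite (f ▷ specOver R T).left ∧ Etale (f ▷ specOver R T).left := by
  -- 1. the model over a finitely generated subalgebra `R ⊆ Ω`
  obtain ⟨R, _, _, ψ, X', G₁, π₁, ℓ₁, hψ, hft, hsep, hlft, hqc, hℓ₁, hℓ₂, hsq⟩ :=
    exists_isPullback_whisker_of_hom_tensorObj X₀ a
  haveI := hsep
  haveI := hlft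
  haveI := hqc
  haveI := hft
  letI : Algebra R Ω := ψ.toRingHom.toAlgebra
  haveI : IsScalarTower K R Ω := IsScalarTower.of_algebraMap_eq fun x ↦ (ψ.commutes x).symm
  haveI : IsDomain R := Function.Injective.isDomain ψ.toRingHom hψ
  haveI : IsNoetherianRing R := Algebra.FiniteType.isNoetherianRing K R
  let P₁ : SchemeOver R := Over.mk (pullback.snd X₀.hom (specOver K R).hom)
  let Xo : SchemeOver R := Over.mk (G₁ ≫ pullback.snd X₀.hom (specOver K R).hom)
  let f : Xo ⟶ P₁ := Over.homMk G₁ rfl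
  -- hypotheses of the spreading theorems
  haveI : QuasiCompact P₁.hom :=
    inferInstanceAs (QuasiCompact (pullback.snd X₀.hom (specOver K R).hom))
  haveI : QuasiCompact f.left := hqc
  haveI : IsSeparated f.left := hsep
  haveI : IsLocallyNoetherian (specOver K R).left :=
    inferInstanceAs (IsLocallyNoetherian (Spec (CommRingCat.of R)))
  haveI : IsLocallyNoetherian (X₀ ⊗ specOver K R).left :=
    LocallyOfFiniteType.isLocallyNoetherian (pullback.snd X₀.hom (specOver K R).hom)
  haveI : LocallyOfFinitePresentation f.left := locallyOfFinitePresentation_of_isLocallyNoetherian' G₁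
  -- the comparison iso at `Ω`; `a ≅ (f ▷ Spec Ω).left` as arrows
  obtain ⟨eΩ, heΩ₁, heΩ₂, heΩ₃⟩ := exists_iso_tensorObj_left X₀ R Ω
  have hℓ : ℓ₁ = eΩ.hom ≫ pullback.fst P₁.hom (specOver R Ω).hom := by
    apply pullback.hom_ext
    · rw [hℓ₁, Category.assoc]; exact heΩ₁.symm
    · rw [hℓ₂, Category.assoc]; exact heΩ₂.symm
  have hsq' : IsPullback π₁ a f.left (eΩ.hom ≫ pullback.fst P₁.hom (specOver R Ω).hom) := by
    rw [← hℓ]; exact hsq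
  obtain ⟨χ, hχ, -⟩ := exists_iso_of_isPullback X₀ f a π₁ eΩ hsq'
  have hfa : (f ▷ specOver R Ω).left = χ.inv ≫ a ≫ eΩ.hom := by
    rw [← hχ, χ.inv_hom_id_assoc]
  haveI : IsFinite (f ▷ specOver R Ω).left := by rw [hfa]; infer_instance
  haveI : Etale (f ▷ specOver R Ω).left := by rw [hfa]; infer_instance
  -- 2. finite étale over `L = Frac R`, by fpqc descent along `X₀ ⊗ Spec Ω → X₀ ⊗ Spec L`
  let L : Type u := FractionRing R
  letI : Algebra L Ω := (IsFractionRing.lift hψ : L →+* Ω).toAlgebra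
  haveI : IsScalarTower R L Ω :=
    IsScalarTower.of_algebraMap_eq fun x ↦ (IsFractionRing.lift_algebraMap hψ x).symm
  let ιL : specOver R Ω ⟶ specOver R L :=
    Over.homMk (Spec.map (CommRingCat.ofHom (algebraMap L Ω))) (specMap_algebraMap_comp_hom L Ω)
  haveI : Flat ιL.left := by
    change Flat (Spec.map (CommRingCat.ofHom (algebraMap L Ω)))
    rw [HasRingHomProperty.Spec_iff (P := @Flat)]
    change (algebraMap L Ω).Flat
    rw [RingHom.flat_algebraMap_iff]
    infer_instance
  haveI : Subsingleton ↥(specOver R L).left := inferInstanceAs (Subsingleton (PrimeSpectrum L))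
  haveI : Nonempty ↥(specOver R Ω).left := inferInstanceAs (Nonempty (PrimeSpectrum Ω))
  haveI : Surjective ιL.left := ⟨Function.surjective_to_subsingleton _⟩
  haveI : IsAffineHom ιL.left := inferInstanceAs (IsAffineHom (Spec.map _))
  haveI : IsSeparated (f ▷ specOver R L).left :=
    MorphismProperty.of_isPullback (LocApprox.isPullback_whiskerRight_left f (specOver R L)).flip hsep
  have W := LocApprox.isPullback_whiskerLeft_whiskerRight_left f (specOver R L) ιL
  obtain ⟨hfinL, hetL⟩ := Morphisms.isFinite_and_etale_of_isPullback W.flip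
  haveI := hfinL
  haveI := hetL
  -- 3. spread from `L` to `R[1/s]`
  obtain ⟨s, hs, hforall⟩ :=
    LocApprox.exists_forall_isFinite_and_etale_whiskerRight (nonZeroDivisors R) L f
  exact ⟨R, inferInstance, inferInstance, inferInstance, inferInstance, inferInstance, Xo, f, χ, eΩ,
    s, hψ, hft, hχ, heΩ₁, heΩ₃, nonZeroDivisors.ne_zero hs, fun t hst T _ _ _ => hforall t hst T⟩

omit [QuasiCompact X₀.hom] [IsSeparated X₀.hom] [LocallyOfFinitePresentation X₀.hom] [IsFinite a]
  [Etale a] in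
/-- **Packaging at the stage `R[1/t]`.** Given the model of
`exists_model_forall_isFinite_and_etale` and `t ≠ 0` in `R` over whose basic open the model is
finite étale, the stage `T = R[1/t]` (an integral domain of finite type over `K`, mapping injectively
to `Ω`) carries a finite étale `G : X'' → X₀ ⊗_K Spec T` of which `a` is the base change.
[folklore] -/
theorem exists_finite_etale_spread_at {R : Type u} [CommRing R] [IsDomain R] [Algebra K R]
    [Algebra R Ω] [IsScalarTower K R Ω] (hinj : Function.Injective (algebraMap R Ω))
    {Xo : SchemeOver R} (f : Xo ⟶ Over.mk (pullback.snd X₀.hom (specOver K R).hom))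
    (χ : X ≅ (Xo ⊗ specOver R Ω).left)
    (eΩ : (X₀ ⊗ specOver K Ω).left ≅
      ((Over.mk (pullback.snd X₀.hom (specOver K R).hom) : SchemeOver R) ⊗ specOver R Ω).left)
    (hχ : χ.hom ≫ (f ▷ specOver R Ω).left = a ≫ eΩ.hom)
    (heΩ₁ : eΩ.hom ≫ pullback.fst _ _ ≫ pullback.fst X₀.hom (specOver K R).hom = pullback.fst _ _)
    (heΩ₃ : eΩ.hom ≫ pullback.snd _ _ = pullback.snd _ _) {t : R} (ht : t ≠ 0)
    (hfin : IsFinite (f ▷ specOver R (Localization.Away t)).left)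
    (het : Etale (f ▷ specOver R (Localization.Away t)).left) :
    ∃ (ψ : Localization.Away t →ₐ[K] Ω) (X'' : Scheme.{u})
      (G : X'' ⟶ (X₀ ⊗ specOver K (Localization.Away t)).left) (π : X ⟶ X'')
      (ℓ : (X₀ ⊗ specOver K Ω).left ⟶ (X₀ ⊗ specOver K (Localization.Away t)).left),
      Function.Injective ψ ∧ IsFinite G ∧ Etale G ∧
      ℓ ≫ pullback.fst _ _ = pullback.fst _ _ ∧
      ℓ ≫ pullback.snd _ _ = pullback.snd _ _ ≫ Spec.map (CommRingCat.ofHom ψ.toRingHom) ∧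
      IsPullback π a G ℓ := by
  set T : Type u := Localization.Away t with hT
  haveI : IsScalarTower K R T := IsScalarTower.of_algebraMap_eq fun x ↦ rfl
  have hinjT : Function.Injective (algebraMap R T) :=
    IsLocalization.injective T (powers_le_nonZeroDivisors_of_noZeroDivisors ht)
  have hunit : IsUnit (algebraMap R Ω t) :=
    (map_ne_zero_iff (algebraMap R Ω) hinj).mpr ht |>.isUnit
  let φ : T →+* Ω := IsLocalization.Away.lift t hunit
  have hφ : φ.comp (algebraMap R T) = algebraMap R Ω := IsLocalization.Away.lift_comp t hunit
  have hφK : ∀ x : K, φ (algebraMap K T x) = algebraMap K Ω x := fun x ↦ by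
    rw [IsScalarTower.algebraMap_apply K R T, ← RingHom.comp_apply, hφ,
      ← IsScalarTower.algebraMap_apply]
  let ψ : T →ₐ[K] Ω := { φ with commutes' := hφK }
  have hψ : Function.Injective ψ := by
    change Function.Injective (IsLocalization.Away.lift t hunit)
    unfold IsLocalization.Away.lift
    exact (IsLocalization.lift_injective_iff _).mpr fun x y ↦
      ⟨fun h ↦ by rw [hinjT h], fun h ↦ by rw [hinj h]⟩
  have hφ' : Spec.map (CommRingCat.ofHom φ) ≫ (specOver R T).hom = (specOver R Ω).hom := by
    change Spec.map _ ≫ Spec.map _ = Spec.map _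
    rw [← Spec.map_comp, ← CommRingCat.ofHom_comp, hφ]
  -- the comparison iso at `T` and the package
  obtain ⟨eT, heT₁, -, heT₃⟩ := exists_iso_tensorObj_left X₀ R T
  obtain ⟨X'', G, π, ℓ, hℓ₁, hℓ₂, hsq, hP⟩ := exists_spread_package X₀ f
    (pullback.fst X₀.hom (specOver K R).hom) a eΩ T φ χ eT hφ' hχ heΩ₁ heΩ₃ heT₁ heT₃
  exact ⟨ψ, X'', G, π, ℓ, hψ, hP _ inferInstance hfin, hP _ inferInstance het, hℓ₁, hℓ₂, hsq⟩

/-- **Spreading out a finite étale cover to a finitely generated subalgebra** (EGA IV₃ 8.8.2 (ii),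
8.10.5 (x), IV₄ 17.7.8 (ii); SGA1 XIII; Voisin 2007, §3). Let `K ⊆ Ω` be fields, `X₀` a
quasi-compact separated `K`-scheme locally of finite presentation and `a : X → X₀ ⊗_K Spec Ω` finite
étale. Then there are an integral domain `R` of finite type over `K` with an injective `K`-algebra
map `ψ : R → Ω`, a finite étale `G : X' → X₀ ⊗_K Spec R`, `π : X → X'` and the base change map
`ℓ : X₀ ⊗_K Spec Ω → X₀ ⊗_K Spec R` (components `(pr₁, pr₂ ≫ Spec ψ)`) with `IsPullback π a G ℓ`: the
given cover is the base change of a finite étale cover defined over `R`.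
[cite: EGAIV3, Thm. 8.8.2 (ii) and Thm. 8.10.5 (x)] [cite: EGAIV4, Prop. 17.7.8 (ii)]
[cite: Voisin2007, §3] -/
theorem exists_finite_etale_spread :
    ∃ (R : Type u) (_ : CommRing R) (_ : IsDomain R) (_ : Algebra K R) (ψ : R →ₐ[K] Ω)
      (X' : Scheme.{u}) (G : X' ⟶ (X₀ ⊗ specOver K R).left) (π : X ⟶ X')
      (ℓ : (X₀ ⊗ specOver K Ω).left ⟶ (X₀ ⊗ specOver K R).left),
      Function.Injective ψ ∧ Algebra.FiniteType K R ∧ IsFinite G ∧ Etale G ∧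
      ℓ ≫ pullback.fst _ _ = pullback.fst _ _ ∧
      ℓ ≫ pullback.snd _ _ = pullback.snd _ _ ≫ Spec.map (CommRingCat.ofHom ψ.toRingHom) ∧
      IsPullback π a G ℓ := by
  obtain ⟨R, _, _, _, _, _, Xo, f, χ, eΩ, s, hinj, hft, hχ, heΩ₁, heΩ₃, hs, hforall⟩ :=
    exists_model_forall_isFinite_and_etale X₀ a
  haveI := hft
  obtain ⟨hfin, het⟩ := hforall s dvd_rfl (Localization.Away s)
  obtain ⟨ψ, X'', G, π, ℓ, hψ, hG, hG', hℓ₁, hℓ₂, hsq⟩ :=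
    exists_finite_etale_spread_at X₀ a hinj f χ eΩ hχ heΩ₁ heΩ₃ hs hfin het
  haveI : IsScalarTower K R (Localization.Away s) := IsScalarTower.of_algebraMap_eq fun x ↦ rfl
  exact ⟨Localization.Away s, inferInstance,
    IsLocalization.isDomain_localization (powers_le_nonZeroDivisors_of_noZeroDivisors hs),
    inferInstance, ψ, X'', G, π, ℓ, hψ,
    Algebra.FiniteType.trans (S := R) hft
      (IsLocalization.finiteType_of_monoid_fg (Submonoid.powers s) (Localization.Away s)),
    hG, hG', hℓ₁, hℓ₂, hsq⟩

/-- **Generic smoothness of a finitely generated domain over a perfect field** (scheme form): for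
`R` a domain of finite type over a perfect field `k` there is `s ≠ 0` in `R` such that
`Spec T → Spec k` is smooth for every localisation `T = R[1/t]` at a multiple `t` of `s` — the
generic point of `Spec R` lies in the open smooth locus of `Spec R → Spec k` (Mathlib
`Scheme.Hom.genericPoint_mem_smoothLocus_of_perfectField`), which therefore contains a basic open
neighbourhood `D(s)`. Same statement and proof as
`HodgeTheory.exists_forall_smooth_specMap_of_perfectField` (kept private here, to keep the imports
of this file light). [cite: EGAIV4, Prop. 17.15.12] -/
private theorem exists_forall_smooth_specMap_of_perfectField' (k R : Type u) [Field k]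
    [PerfectField k] [CommRing R] [IsDomain R] [Algebra k R] [Algebra.FiniteType k R] :
    ∃ s : R, s ≠ 0 ∧ ∀ t : R, s ∣ t → ∀ (T : Type u) [CommRing T] [Algebra R T] [Algebra k T]
      [IsScalarTower k R T] [IsLocalization.Away t T],
      Smooth (Spec.map (CommRingCat.ofHom (algebraMap k T))) := by
  set q := Spec.map (CommRingCat.ofHom (algebraMap k R)) with hq
  haveI : IsNoetherianRing R := Algebra.FiniteType.isNoetherianRing k R
  haveI : LocallyOfFiniteType q := by
    rw [hq, HasRingHomProperty.Spec_iff (P := @LocallyOfFiniteType)]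
    exact RingHom.finiteType_algebraMap.mpr ‹_›
  haveI : IsLocallyNoetherian (Spec (CommRingCat.of k)) := inferInstance
  haveI : LocallyOfFinitePresentation q := locallyOfFinitePresentation_of_isLocallyNoetherian' q
  have hη : genericPoint (Spec (.of R)) ∈ q.smoothLocus :=
    Scheme.Hom.genericPoint_mem_smoothLocus_of_perfectField q
  obtain ⟨_, ⟨_, ⟨s, rfl⟩, rfl⟩, hηs, hsU⟩ :=
    PrimeSpectrum.isBasis_basic_opens.exists_subset_of_mem_open hη q.smoothLocus.isOpen
  have hs0 : s ≠ 0 := by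
    intro h0
    rw [h0, PrimeSpectrum.basicOpen_zero] at hηs
    exact hηs
  refine ⟨s, hs0, fun t hst T _ _ _ _ _ ↦ ?_⟩
  set jT := Spec.map (CommRingCat.ofHom (algebraMap R T)) with hjT
  haveI : IsOpenImmersion jT := IsOpenImmersion.of_isLocalization t
  have hrange : Set.range jT ⊆ (q.smoothLocus : Set (Spec (.of R))) := by
    rw [hjT]
    change Set.range (PrimeSpectrum.comap (algebraMap R T)) ⊆ _
    rw [PrimeSpectrum.localization_away_comap_range T t]
    refine subset_trans ?_ hsU
    obtain ⟨c, rfl⟩ := hst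
    exact PrimeSpectrum.basicOpen_mul_le_left s c
  have hcomp : jT ≫ q = Spec.map (CommRingCat.ofHom (algebraMap k T)) := by
    rw [hjT, hq, ← Spec.map_comp, ← CommRingCat.ofHom_comp, ← IsScalarTower.algebraMap_eq]
  rw [← hcomp, ← Scheme.Hom.smoothLocus_eq_top_iff, ← Scheme.Hom.preimage_smoothLocus_eq jT q,
    LocApprox.preimage_eq_top_iff_range_subset]
  exact hrange

/-- **Spreading out a finite étale cover to a SMOOTH affine `K`-variety inside `Ω`** (`K` perfect,
e.g. `ℚ̄`): as `exists_finite_etale_spread`, and moreover `Spec R → Spec K` is smooth (generic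
smoothness, EGA IV₄ 17.15.12: shrink `Spec R` to a basic open on which it is smooth). This is the
form used to descend finite étale covers of `S₀ ⊗_{ℚ̄} ℂ` to `ℚ̄`-points along paths in the complex
manifold `(Spec R)(ℂ)` (Voisin 2007, §3). [cite: EGAIV3, Thm. 8.8.2 (ii) and Thm. 8.10.5 (x)]
[cite: EGAIV4, Prop. 17.7.8 (ii) and Prop. 17.15.12] [cite: Voisin2007, §3] -/
theorem exists_finite_etale_spread_smooth [PerfectField K] :
    ∃ (R : Type u) (_ : CommRing R) (_ : IsDomain R) (_ : Algebra K R) (ψ : R →ₐ[K] Ω)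
      (X' : Scheme.{u}) (G : X' ⟶ (X₀ ⊗ specOver K R).left) (π : X ⟶ X')
      (ℓ : (X₀ ⊗ specOver K Ω).left ⟶ (X₀ ⊗ specOver K R).left),
      Function.Injective ψ ∧ Algebra.FiniteType K R ∧ Smooth (specOver K R).hom ∧
      IsFinite G ∧ Etale G ∧
      ℓ ≫ pullback.fst _ _ = pullback.fst _ _ ∧
      ℓ ≫ pullback.snd _ _ = pullback.snd _ _ ≫ Spec.map (CommRingCat.ofHom ψ.toRingHom) ∧
      IsPullback π a G ℓ := by
  obtain ⟨R, _, _, _, _, _, Xo, f, χ, eΩ, s, hinj, hft, hχ, heΩ₁, heΩ₃, hs, hforall⟩ :=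
    exists_model_forall_isFinite_and_etale X₀ a
  haveI := hft
  obtain ⟨s', hs', hsmooth⟩ := exists_forall_smooth_specMap_of_perfectField' K R
  have hss' : s * s' ≠ 0 := mul_ne_zero hs hs'
  haveI : IsScalarTower K R (Localization.Away (s * s')) :=
    IsScalarTower.of_algebraMap_eq fun x ↦ rfl
  obtain ⟨hfin, het⟩ := hforall (s * s') (dvd_mul_right s s') (Localization.Away (s * s'))
  obtain ⟨ψ, X'', G, π, ℓ, hψ, hG, hG', hℓ₁, hℓ₂, hsq⟩ :=
    exists_finite_etale_spread_at X₀ a hinj f χ eΩ hχ heΩ₁ heΩ₃ hss' hfin het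
  exact ⟨Localization.Away (s * s'), inferInstance,
    IsLocalization.isDomain_localization (powers_le_nonZeroDivisors_of_noZeroDivisors hss'),
    inferInstance, ψ, X'', G, π, ℓ, hψ,
    Algebra.FiniteType.trans (S := R) hft
      (IsLocalization.finiteType_of_monoid_fg (Submonoid.powers (s * s')) (Localization.Away (s * s'))),
    hsmooth (s * s') (dvd_mul_left s' s) (Localization.Away (s * s')),
    hG, hG', hℓ₁, hℓ₂, hsq⟩

end Main

end Literature.AlgebraicGeometry.Limits

end
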